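import Literature.Probability.Percolation.TreeGraphBoundGeneral
import Literature.Barriers.CriticalPhenomena.SpanningClustersAboveSixMoments
import Literature.Barriers.CriticalPhenomena.KozmaNachmiasLemma43
import HarnessLib

/-!
# Kozma–Nachmias 2011, Lemma 4.4 (Aizenman 1997, Lemma 2): large clusters in a box are
# exponentially unlikely on the scale `s⁴` — PROVED

Barrier catalogue `Literature/Barriers/CriticalPhenomena/` (D-0021), programme for the named fact
`KozmaNachmias2011_thm4` (`KozmaNachmiasRegularity.lean`). Lemma 4.4 of Kozma–Nachmias 2011
(p. 392),

> `P(max_{y ∈ Q_s} |C(y) ∩ Q_s| > λ s⁴) ≤ s^{d-6} e^{-cλ}`,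

"a well-known corollary of the so-called diagrammatic bounds": by Aizenman 1997, §4.3, Lemma 2,
`E(Σ_{C ⊂ Λ} |C|^k) = Σ_{x_1,…,x_k} τ_k(x_1,…,x_k) ≤ k! C₁^k s^{d-6+4k}` (the tree-diagram bound of
Aizenman–Newman 1984 and lattice sums of `|x|^{2-d}`), and if `|C| > λ s⁴` for some cluster then
`Σ_C |C|^k ≥ λ^k s^{4k}`; Markov and optimisation over `k` give the claim. This file PROVES the
estimate at `p = p_c` on `ℤ^d`, `d > 6`, under the two-point bound (1.2) (`TwoPointBoundedRatio d`),
in the form `VolumeLD d` consumed by Lemma 4.3 (`KozmaNachmiasLemma43.lean`): boxes `x + Q_s`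
centred anywhere, all `λ > 0`, a constant in front, and the prefactor `s^{d-4}` in place of
`s^{d-6}` (see below) — `volumeLD_of_twoPointBoundedRatio`.

Architecture (following Aizenman 1997, §4.3, with the root of the diagrams pinned):

* **Lattice sums** (`d = m + 7`, Riesz weights `rieszWt a z = max(1,‖z‖_∞)^{-a}` of
  `SpanningClustersAboveSixLatticeSums.lean`): with the profile `g(z) = (s+1)² max(1,‖z-x‖)^{-2}`,
  the leaf sum `Σ_{y ∈ x+Q_s} |z-y|^{2-d} ≤ K (s+1)² g(z)` (`sum_cubeAt_rieszWt_le`) and the vertex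
  sum `Σ_u |z-u|^{2-d} g(u)² ≤ K (s+1)² g(z)` (`sum_rieszWt_mul_profile_sq_le`, the discrete
  convolution `|x|^{2-d} * |x|^{-4} ≲ |x|^{-2}` of `sum_rieszWt_mul_rieszWt_le`). Hence, by
  induction over the shape, **every tree diagram with `2k+1` lines, leaves summed over the box and
  internal vertices over any finite set, is `≤ (C₁K)^{2k+1} (s+1)^{4k+2} g(root)`**
  (`treeSum_le`). (Pinning the root and using the unsaturated profile `g` costs a factor `s²`
  against Aizenman's `s^{d-6+4k}` for the fully summed diagram; this is the origin of `s^{d-4}`.)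
* **Moments** (`sum_moment_le`): by the general tree-graph bound
  `ConnDiagram.real_iInter_openConnIn_le_sum_val` (`TreeGraphBoundGeneral.lean`), summing the
  `k+1` leaves over the box and the shapes over `diagramsOf k` (`≤ catalan k · (k+1)!` diagrams),
  `Σ_{u ∈ B} E[N_u^{k+1}] ≤ |B| (k+1)! 4^k (C₁K)^{2k+1} (s+1)^{4k+4}`, where
  `N_u = |{z ∈ B : u ↔ z in S}|`, `B = x + Q_s`, for every finite `S`.
* **Markov and optimisation** (`real_exists_large_cluster_le`): on `{∃ y ∈ B, N_y > λ s⁴}` one has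
  `Σ_{u ∈ B} N_u^{k+1} ≥ (λ s⁴)^{k+2}` (the `N_y` vertices of the class of `y` all have the same
  `N`), so `P ≤ 3^d s^{d-4} (k+1)! (A/λ)^{k+1} / λ`; the choice `k + 1 = ⌊λ/(eA)⌋` gives
  `C s^{d-4} e^{-λ/(eA)}`.
* **Infinite volume** (`volumeLD_of_twoPointBoundedRatio`): the events for `S = Λ_n ↑ ℤ^d` increase
  to the event for the clusters of `ℤ^d`, and the bound passes to the limit.

## References

* G. Kozma, A. Nachmias, *Arm exponents in high dimensional percolation*, J. Amer. Math. Soc. 24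
  (2011) 375–409: Lemma 4.4 and its proof (p. 392).
* M. Aizenman, *On the number of incipient spanning clusters*, Nuclear Phys. B 485 (1997)
  551–582: §4.3, Lemma 2 (first display) and its proof ("Derivation of the moment bounds":
  the identity `E(Σ|C|^k) = Σ τ_k`, the tree–diagram bound, `(2k-5)!! ≤ 2^k k!` diagrams,
  `L^{d(2k-2)}/L^{(d-2)(2k-3)}`), and the Chebyshev/optimisation step of the proof of Thm. 5.
* M. Aizenman, C. M. Newman, J. Stat. Phys. 36 (1984) 107–143, §4 (tree graph inequalities).
* T. Hara, R. van der Hofstad, G. Slade, Ann. Probab. 31 (2003), Prop. 1.7 (i) (discrete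
  convolutions of `|x|^{-a}`).
-/

noncomputable section

namespace Literature.Barriers.CriticalPhenomena

open _root_.MeasureTheory Finset Literature.Probability.LatticeModels Literature.Probability.Percolation
  Literature.Probability.Percolation.DCT16
open scoped Literature.Probability.LatticeModels Literature.Probability.Percolation

variable {m : ℕ}

/-! ### Lattice sums: the leaf sum and the vertex sum for the profile `g` -/

section Lattice

/-- Symmetry of the integer sup norm of a difference. [folklore] -/
theorem supNorm_sub_comm' {d : ℕ} (x y : Site d) : Site.supNorm (x - y) = Site.supNorm (y - x) := by
  rw [← neg_sub y x, Site.supNorm_neg']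

/-- The constant of the leaf sum. [folklore] -/
def leafConst (m : ℕ) : ℝ := 36 * rieszBallConst (m + 7) + 2 ^ (m + 9)

/-- `leafConst m ≥ 1`. [folklore] -/
theorem one_le_leafConst (m : ℕ) : 1 ≤ leafConst m := by
  have h1 := one_le_rieszBallConst (m + 7)
  have h2 : (1 : ℝ) ≤ 2 ^ (m + 9) := one_le_pow₀ (by norm_num)
  unfold leafConst; nlinarith

/-- **The leaf sum**: `Σ_{y ∈ x + Q_s} max(1,‖z-y‖)^{-(d-2)} ≤ K (s+1)⁴ max(1,‖z-x‖)^{-2}`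
(`d = m + 7`). For `‖z-x‖ ≤ 2s+1` this is the ball sum of the Riesz weight over radius `3s+1`
(`≤ K₁ (3s+2)²`), for `‖z-x‖ ≥ 2s+2` every term is `≤ 2^{d-2} ‖z-x‖^{2-d}` and there are `(2s+1)^d`
of them. [folklore] -/
theorem sum_cubeAt_rieszWt_le (x z : Site (m + 7)) (s : ℕ) :
    ∑ y ∈ cubeAt x s, rieszWt (m + 5) (z - y) ≤ leafConst m * ((s : ℝ) + 1) ^ 4 * rieszWt 2 (z - x) := by
  classical
  set R := Site.supNorm (z - x) with hR
  have hK₁ := one_le_rieszBallConst (m + 7)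
  have hA : (0 : ℝ) < (s : ℝ) + 1 := by positivity
  have hrad2 : 0 < rieszWt 2 (z - x) := rieszWt_pos 2 _
  by_cases hfar : 2 * s + 2 ≤ R
  · -- far: termwise bound
    have hR1 : 1 ≤ R := by omega
    have hrad : rieszRadius (z - x) = R := rieszRadius_eq_supNorm hR1
    have hRpos : (0 : ℝ) < (R : ℝ) := by exact_mod_cast hR1
    have hterm : ∀ y ∈ cubeAt x s,
        rieszWt (m + 5) (z - y) ≤ 2 ^ (m + 5) * (((R : ℕ) : ℝ) ^ (m + 5))⁻¹ := by
      intro y hy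
      have hyx : Site.supNorm (y - x) ≤ s := mem_cubeAt_iff_supNorm.1 hy
      have htri : Site.supNorm (z - x) ≤ Site.supNorm (z - y) + Site.supNorm (y - x) :=
        supNorm_sub_le z y x
      have hzy : R - s ≤ Site.supNorm (z - y) := by omega
      calc rieszWt (m + 5) (z - y)
          ≤ ((((R - s : ℕ)) : ℝ) ^ (m + 5))⁻¹ := rieszWt_le_inv_pow _ (by omega) hzy
        _ ≤ 2 ^ (m + 5) * (((R : ℕ) : ℝ) ^ (m + 5))⁻¹ :=
            inv_pow_le_two_pow_mul_inv_pow (m + 5) hR1 (by omega)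
    have hR2 : 2 * ((s : ℝ) + 1) ≤ R := by
      have : ((2 * s + 2 : ℕ) : ℝ) ≤ R := by exact_mod_cast hfar
      push_cast at this; linarith
    have h2A : (0 : ℝ) < 2 * ((s : ℝ) + 1) := by positivity
    calc ∑ y ∈ cubeAt x s, rieszWt (m + 5) (z - y)
        ≤ ∑ _y ∈ cubeAt x s, (2 : ℝ) ^ (m + 5) * (((R : ℕ) : ℝ) ^ (m + 5))⁻¹ := Finset.sum_le_sum hterm
      _ = (2 * (s : ℝ) + 1) ^ (m + 7) * 2 ^ (m + 5) * (((R : ℝ) ^ (m + 3))⁻¹ * ((R : ℝ) ^ 2)⁻¹) := by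
          rw [Finset.sum_const, card_cubeAt, nsmul_eq_mul, ← mul_inv, ← pow_add]; push_cast; ring
      _ ≤ (2 * ((s : ℝ) + 1)) ^ (m + 7) * 2 ^ (m + 5) *
            (((2 * ((s : ℝ) + 1)) ^ (m + 3))⁻¹ * ((R : ℝ) ^ 2)⁻¹) := by
          gcongr
          · linarith
      _ = 2 ^ (m + 9) * ((s : ℝ) + 1) ^ 4 * ((R : ℝ) ^ 2)⁻¹ := by
          field_simp; ring
      _ ≤ leafConst m * ((s : ℝ) + 1) ^ 4 * rieszWt 2 (z - x) := by
          rw [rieszWt, hrad]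
          refine mul_le_mul_of_nonneg_right (mul_le_mul_of_nonneg_right ?_ (by positivity))
            (by positivity)
          unfold leafConst; nlinarith
  · -- near: ball sum
    have hall : ∀ y ∈ cubeAt x s, z - y ∈ box (m + 7) (3 * s + 1) := by
      intro y hy
      have hyx : Site.supNorm (y - x) ≤ s := mem_cubeAt_iff_supNorm.1 hy
      have htri := supNorm_sub_le z x y
      rw [supNorm_sub_comm' x y] at htri
      rw [mem_box_iff_supNorm_le]; omega
    have hsum : ∑ y ∈ cubeAt x s, rieszWt (m + 5) (z - y) ≤
        rieszBallConst (m + 7) * (((3 * s + 1 : ℕ) : ℝ) + 1) ^ (1 + 1) := by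
      have h := sum_filter_sub_left_mem_box_le (a := m + 5) (e := 1) (by omega) z (3 * s + 1) (cubeAt x s)
      rwa [Finset.filter_true_of_mem hall] at h
    have hrad : (rieszRadius (z - x) : ℝ) ≤ 2 * ((s : ℝ) + 1) := by
      have h1 : rieszRadius (z - x) ≤ 2 * s + 2 := by
        unfold rieszRadius; exact max_le (by omega) (by omega)
      have : ((rieszRadius (z - x) : ℕ) : ℝ) ≤ ((2 * s + 2 : ℕ) : ℝ) := by exact_mod_cast h1
      push_cast at this; linarith
    have hlow : ((2 * ((s : ℝ) + 1)) ^ 2)⁻¹ ≤ rieszWt 2 (z - x) := by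
      rw [rieszWt]
      exact inv_anti₀ (pow_pos (rieszRadius_pos _) 2) (pow_le_pow_left₀ (rieszRadius_pos _).le hrad 2)
    calc ∑ y ∈ cubeAt x s, rieszWt (m + 5) (z - y)
        ≤ rieszBallConst (m + 7) * (((3 * s + 1 : ℕ) : ℝ) + 1) ^ (1 + 1) := hsum
      _ ≤ rieszBallConst (m + 7) * (3 * ((s : ℝ) + 1)) ^ 2 := by
          push_cast
          refine mul_le_mul_of_nonneg_left (pow_le_pow_left₀ (by positivity) (by linarith) 2)
            (by linarith)
      _ = 36 * rieszBallConst (m + 7) * ((s : ℝ) + 1) ^ 4 * ((2 * ((s : ℝ) + 1)) ^ 2)⁻¹ := by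
          field_simp; ring
      _ ≤ 36 * rieszBallConst (m + 7) * ((s : ℝ) + 1) ^ 4 * rieszWt 2 (z - x) :=
          mul_le_mul_of_nonneg_left hlow (by positivity)
      _ ≤ leafConst m * ((s : ℝ) + 1) ^ 4 * rieszWt 2 (z - x) := by
          refine mul_le_mul_of_nonneg_right (mul_le_mul_of_nonneg_right ?_ (by positivity)) hrad2.le
          unfold leafConst
          have : (0 : ℝ) ≤ 2 ^ (m + 9) := by positivity
          linarith

/-- The profile `g(z) = (s+1)² max(1,‖z-x‖)^{-2}` of the analytic induction. [folklore] -/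
def profile (x : Site (m + 7)) (s : ℕ) (z : Site (m + 7)) : ℝ := ((s : ℝ) + 1) ^ 2 * rieszWt 2 (z - x)

/-- `g ≥ 0`. [folklore] -/
theorem profile_nonneg (x : Site (m + 7)) (s : ℕ) (z : Site (m + 7)) : 0 ≤ profile x s z :=
  mul_nonneg (by positivity) (rieszWt_nonneg _ _)

/-- `g(z) ≤ (s+1)²`. [folklore] -/
theorem profile_le (x : Site (m + 7)) (s : ℕ) (z : Site (m + 7)) : profile x s z ≤ ((s : ℝ) + 1) ^ 2 :=
  (mul_le_mul_of_nonneg_left (rieszWt_le_one _ _) (by positivity)).trans_eq (mul_one _)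

/-- The leaf sum in terms of the profile: `Σ_{y ∈ x+Q_s} |z-y|^{2-d} ≤ K (s+1)² g(z)`. [folklore] -/
theorem sum_cubeAt_rieszWt_le_profile (x z : Site (m + 7)) (s : ℕ) :
    ∑ y ∈ cubeAt x s, rieszWt (m + 5) (z - y) ≤ leafConst m * ((s : ℝ) + 1) ^ 2 * profile x s z := by
  have h := sum_cubeAt_rieszWt_le x z s
  rw [profile]
  linarith [h]

/-- **The vertex sum**: `Σ_{u ∈ S} |z-u|^{2-d} g(u)² ≤ K_conv (s+1)² g(z)`, the discrete convolution
`|x|^{2-d} * |x|^{-4} ≲ |x|^{-2}` (`sum_rieszWt_mul_rieszWt_le` with exponents `d-2` and `4`).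
[cite: HaraHofstadSlade2003, Prop. 1.7 (i)] -/
theorem sum_rieszWt_mul_profile_sq_le (x z : Site (m + 7)) (s : ℕ) (S : Finset (Site (m + 7))) :
    ∑ u ∈ S, rieszWt (m + 5) (z - u) * profile x s u ^ 2 ≤
      rieszConvConst (m + 7) * ((s : ℝ) + 1) ^ 2 * profile x s z := by
  have hconv := sum_rieszWt_mul_rieszWt_le (t := 1) (i := 1) (j := m + 2) (d := m + 7) (by omega) z x S
  have h4 : ∀ u, rieszWt (1 + 2 + 1) (u - x) = rieszWt 2 (u - x) ^ 2 := fun u => by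
    rw [show (1 + 2 + 1 : ℕ) = 2 + 2 from rfl, rieszWt_add, sq]
  have h5 : 1 + 2 + (m + 2) = m + 5 := by omega
  rw [h5, show (1 + 1 : ℕ) = 2 from rfl] at hconv
  simp_rw [h4] at hconv
  calc ∑ u ∈ S, rieszWt (m + 5) (z - u) * profile x s u ^ 2
      = ((s : ℝ) + 1) ^ 4 * ∑ u ∈ S, rieszWt (m + 5) (z - u) * rieszWt 2 (u - x) ^ 2 := by
        rw [Finset.mul_sum]
        refine Finset.sum_congr rfl fun u _ => ?_
        rw [profile]; ring
    _ ≤ ((s : ℝ) + 1) ^ 4 * (rieszConvConst (m + 7) * rieszWt 2 (z - x)) :=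
        mul_le_mul_of_nonneg_left hconv (by positivity)
    _ = rieszConvConst (m + 7) * ((s : ℝ) + 1) ^ 2 * profile x s z := by rw [profile]; ring

end Lattice

/-! ### Tree sums: every diagram is `≤ (C₁K)^{lines} (s+1)^{2·lines} g(root)` -/

section TreeSum

/-- **The fully summed tree diagram** of shape `T` read from `z`: leaves summed over `B`, internal
vertices over `S`, kernel `t` (`Σ_{y ∈ B} t(z,y)` for a leaf; `Σ_{u ∈ S} t(z,u) · l(u) · r(u)` for a
node). [cite: Aizenman1997, §4.3 (tree diagrams: external vertices in Λ, internal summed)] -/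
def treeSum (B S : Finset (Site (m + 7))) (t : Site (m + 7) → Site (m + 7) → ℝ) :
    BinaryTree Unit → Site (m + 7) → ℝ
  | BinaryTree.nil, z => ∑ y ∈ B, t z y
  | BinaryTree.node _ l r, z => ∑ u ∈ S, t z u * (treeSum B S t l u * treeSum B S t r u)

/-- The number of lines of a shape: `2 · #internal vertices + 1`. [folklore] -/
def shapeLines (T : BinaryTree Unit) : ℕ := 2 * T.numNodes + 1

/-- Lines of a node. [folklore] -/
theorem shapeLines_node (a : Unit) (l r : BinaryTree Unit) :
    shapeLines (BinaryTree.node a l r) = shapeLines l + shapeLines r + 1 := by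
  simp only [shapeLines, BinaryTree.numNodes]; ring

/-- Tree sums of a nonnegative kernel are nonnegative. [folklore] -/
theorem treeSum_nonneg (B S : Finset (Site (m + 7))) {t : Site (m + 7) → Site (m + 7) → ℝ}
    (ht : ∀ a b, 0 ≤ t a b) : ∀ (T : BinaryTree Unit) (z : Site (m + 7)), 0 ≤ treeSum B S t T z := by
  intro T
  induction T with
  | nil => intro z; exact Finset.sum_nonneg fun y _ => ht z y
  | node _ l r ihl ihr =>
    intro z; exact Finset.sum_nonneg fun u _ => mul_nonneg (ht z u) (mul_nonneg (ihl u) (ihr u))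

/-- The two-point kernel `t(a,b) = C₁ max(1,‖a-b‖)^{-(d-2)}`. [cite: Aizenman1997, §4 (condition (t-c))] -/
def twoPtKernel (C₁ : ℝ) (a b : Site (m + 7)) : ℝ := C₁ * rieszWt (m + 5) (a - b)

/-- The constant `K = max(K_leaf, K_conv)` of the analytic induction. [folklore] -/
def vertexConst (m : ℕ) : ℝ := max (leafConst m) (rieszConvConst (m + 7))

/-- `vertexConst m ≥ 1`. [folklore] -/
theorem one_le_vertexConst (m : ℕ) : 1 ≤ vertexConst m :=
  (one_le_leafConst m).trans (le_max_left _ _)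

/-- **The analytic induction** (Aizenman 1997, §4.3: "each diagram has `(2k-2)` vertices and
`(2k-3)` lines … `L^{d(2k-2)}/L^{(d-2)(2k-3)}`", here with the root pinned): for `C₁ ≥ 1`, every
tree sum of shape `T` with leaves over `x + Q_s`, internal vertices over any finite `S` and kernel
`C₁ |a-b|^{2-d}` is at most `(C₁K)^{lines T} (s+1)^{2 lines T} g(z)`, by the leaf sum at the leaves
and the vertex sum at the internal vertices. [cite: Aizenman1997, §4.3 (proof of Lemma 2)] -/
theorem treeSum_le (x : Site (m + 7)) (s : ℕ) (S : Finset (Site (m + 7))) {C₁ : ℝ} (hC₁ : 1 ≤ C₁) :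
    ∀ (T : BinaryTree Unit) (z : Site (m + 7)),
      treeSum (cubeAt x s) S (twoPtKernel C₁) T z ≤
        (C₁ * vertexConst m) ^ shapeLines T * ((s : ℝ) + 1) ^ (2 * shapeLines T) * profile x s z := by
  have hK := one_le_vertexConst m
  have hC0 : 0 ≤ C₁ := zero_le_one.trans hC₁
  have hCK : 1 ≤ C₁ * vertexConst m := one_le_mul_of_one_le_of_one_le hC₁ hK
  intro T
  induction T with
  | nil =>
    intro z
    have h := sum_cubeAt_rieszWt_le_profile x z s
    have hg := profile_nonneg x s z
    calc treeSum (cubeAt x s) S (twoPtKernel C₁) BinaryTree.nil z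
        = C₁ * ∑ y ∈ cubeAt x s, rieszWt (m + 5) (z - y) := by
          simp only [treeSum, twoPtKernel, Finset.mul_sum]
      _ ≤ C₁ * (leafConst m * ((s : ℝ) + 1) ^ 2 * profile x s z) := mul_le_mul_of_nonneg_left h hC0
      _ ≤ (C₁ * vertexConst m) ^ shapeLines BinaryTree.nil *
            ((s : ℝ) + 1) ^ (2 * shapeLines BinaryTree.nil) * profile x s z := by
          simp only [shapeLines, BinaryTree.numNodes, mul_zero, zero_add, pow_one, mul_one]
          have : leafConst m ≤ vertexConst m := le_max_left _ _
          have h2 : 0 ≤ ((s : ℝ) + 1) ^ 2 * profile x s z := by positivity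
          nlinarith [mul_le_mul_of_nonneg_right this h2]
  | node a l r ihl ihr =>
    intro z
    set el := shapeLines l
    set er := shapeLines r
    have hsl : shapeLines (BinaryTree.node a l r) = el + er + 1 := shapeLines_node a l r
    have ht0 : ∀ a b : Site (m + 7), 0 ≤ twoPtKernel C₁ a b :=
      fun a b => mul_nonneg hC0 (rieszWt_nonneg _ _)
    -- bound the two subtrees, then the vertex sum
    have hstep : ∀ u ∈ S, twoPtKernel C₁ z u *
        (treeSum (cubeAt x s) S (twoPtKernel C₁) l u * treeSum (cubeAt x s) S (twoPtKernel C₁) r u) ≤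
        C₁ * ((C₁ * vertexConst m) ^ (el + er) * ((s : ℝ) + 1) ^ (2 * (el + er))) *
          (rieszWt (m + 5) (z - u) * profile x s u ^ 2) := by
      intro u _
      have h1 := ihl u
      have h2 := ihr u
      have h1' := treeSum_nonneg (cubeAt x s) S ht0 l u
      have h2' := treeSum_nonneg (cubeAt x s) S ht0 r u
      have hprod : treeSum (cubeAt x s) S (twoPtKernel C₁) l u * treeSum (cubeAt x s) S (twoPtKernel C₁) r u ≤
          ((C₁ * vertexConst m) ^ el * ((s : ℝ) + 1) ^ (2 * el) * profile x s u) *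
            ((C₁ * vertexConst m) ^ er * ((s : ℝ) + 1) ^ (2 * er) * profile x s u) :=
        mul_le_mul h1 h2 h2' (h1'.trans h1)
      calc twoPtKernel C₁ z u *
            (treeSum (cubeAt x s) S (twoPtKernel C₁) l u * treeSum (cubeAt x s) S (twoPtKernel C₁) r u)
          ≤ twoPtKernel C₁ z u * (((C₁ * vertexConst m) ^ el * ((s : ℝ) + 1) ^ (2 * el) * profile x s u) *
              ((C₁ * vertexConst m) ^ er * ((s : ℝ) + 1) ^ (2 * er) * profile x s u)) :=
            mul_le_mul_of_nonneg_left hprod (ht0 z u)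
        _ = C₁ * ((C₁ * vertexConst m) ^ (el + er) * ((s : ℝ) + 1) ^ (2 * (el + er))) *
              (rieszWt (m + 5) (z - u) * profile x s u ^ 2) := by
            rw [twoPtKernel]; ring
    calc treeSum (cubeAt x s) S (twoPtKernel C₁) (BinaryTree.node a l r) z
        = ∑ u ∈ S, twoPtKernel C₁ z u *
            (treeSum (cubeAt x s) S (twoPtKernel C₁) l u * treeSum (cubeAt x s) S (twoPtKernel C₁) r u) := rfl
      _ ≤ ∑ u ∈ S, C₁ * ((C₁ * vertexConst m) ^ (el + er) * ((s : ℝ) + 1) ^ (2 * (el + er))) *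
            (rieszWt (m + 5) (z - u) * profile x s u ^ 2) := Finset.sum_le_sum hstep
      _ = C₁ * ((C₁ * vertexConst m) ^ (el + er) * ((s : ℝ) + 1) ^ (2 * (el + er))) *
            ∑ u ∈ S, rieszWt (m + 5) (z - u) * profile x s u ^ 2 := by rw [Finset.mul_sum]
      _ ≤ C₁ * ((C₁ * vertexConst m) ^ (el + er) * ((s : ℝ) + 1) ^ (2 * (el + er))) *
            (rieszConvConst (m + 7) * ((s : ℝ) + 1) ^ 2 * profile x s z) :=
          mul_le_mul_of_nonneg_left (sum_rieszWt_mul_profile_sq_le x z s S) (by positivity)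
      _ ≤ C₁ * ((C₁ * vertexConst m) ^ (el + er) * ((s : ℝ) + 1) ^ (2 * (el + er))) *
            (vertexConst m * ((s : ℝ) + 1) ^ 2 * profile x s z) := by
          gcongr
          · exact profile_nonneg x s z
          · exact le_max_right _ _
      _ = (C₁ * vertexConst m) ^ shapeLines (BinaryTree.node a l r) *
            ((s : ℝ) + 1) ^ (2 * shapeLines (BinaryTree.node a l r)) * profile x s z := by
          rw [hsl]; ring

end TreeSum

/-! ### Moments: `Σ_y P(u ↔ y₀, …, u ↔ y_k in S) ≤ (k+1)! Σ_T treeSum T u` -/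

section Moments

/-- Summing the canonical diagram of shape `T` over all positions of its leaves in `B` gives the
tree sum: the sum over `y : Fin (n_l + n_r) → B` factorises along `Fin.appendEquiv`. [folklore] -/
theorem sum_val_canon_eq_treeSum (B S : Finset (Site (m + 7))) (t : Site (m + 7) → Site (m + 7) → ℝ) :
    ∀ (T : BinaryTree Unit) (z : Site (m + 7)),
      ∑ y : Fin T.numLeaves → ↥B, ConnDiagram.val S t (fun i => ((y i : ↥B) : Site (m + 7)))
        (ConnDiagram.canon T) z = treeSum B S t T z := by
  intro T
  induction T with
  | nil =>
    intro z
    rw [ConnDiagram.canon_nil]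
    simp only [treeSum]
    rw [← Finset.sum_coe_sort B (fun y => t z y)]
    exact Fintype.sum_equiv (Equiv.funUnique (Fin 1) ↥B) _ _ fun y => rfl
  | node a l r ihl ihr =>
    intro z
    cases a
    show ∑ y : Fin (l.numLeaves + r.numLeaves) → ↥B,
        ConnDiagram.val S t (fun i => ((y i : ↥B) : Site (m + 7)))
          (ConnDiagram.canon (BinaryTree.node () l r)) z = _
    rw [ConnDiagram.canon_node]
    simp only [ConnDiagram.val_node, ConnDiagram.val_map, treeSum]
    rw [Finset.sum_comm]
    refine Finset.sum_congr rfl fun u _ => ?_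
    rw [← Finset.mul_sum]
    congr 1
    calc ∑ y : Fin (l.numLeaves + r.numLeaves) → ↥B,
          ConnDiagram.val S t ((fun i => ((y i : ↥B) : Site (m + 7))) ∘ Fin.castAdd r.numLeaves)
              (ConnDiagram.canon l) u *
            ConnDiagram.val S t ((fun i => ((y i : ↥B) : Site (m + 7))) ∘ Fin.natAdd l.numLeaves)
              (ConnDiagram.canon r) u
        = ∑ q : (Fin l.numLeaves → ↥B) × (Fin r.numLeaves → ↥B),
            ConnDiagram.val S t (fun i => ((q.1 i : ↥B) : Site (m + 7))) (ConnDiagram.canon l) u *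
              ConnDiagram.val S t (fun i => ((q.2 i : ↥B) : Site (m + 7))) (ConnDiagram.canon r) u := by
          refine Fintype.sum_equiv (Fin.appendEquiv l.numLeaves r.numLeaves).symm _ _ fun y => ?_
          simp only [Fin.appendEquiv_symm_apply]
          rfl
      _ = ∑ a : Fin l.numLeaves → ↥B, ∑ b : Fin r.numLeaves → ↥B,
            ConnDiagram.val S t (fun i => ((a i : ↥B) : Site (m + 7))) (ConnDiagram.canon l) u *
              ConnDiagram.val S t (fun i => ((b i : ↥B) : Site (m + 7))) (ConnDiagram.canon r) u :=
          Fintype.sum_prod_type' fun (a : Fin l.numLeaves → ↥B) (b : Fin r.numLeaves → ↥B) =>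
            ConnDiagram.val S t (fun i => ((a i : ↥B) : Site (m + 7))) (ConnDiagram.canon l) u *
              ConnDiagram.val S t (fun i => ((b i : ↥B) : Site (m + 7))) (ConnDiagram.canon r) u
      _ = (∑ a : Fin l.numLeaves → ↥B,
            ConnDiagram.val S t (fun i => ((a i : ↥B) : Site (m + 7))) (ConnDiagram.canon l) u) *
            ∑ b : Fin r.numLeaves → ↥B,
              ConnDiagram.val S t (fun i => ((b i : ↥B) : Site (m + 7))) (ConnDiagram.canon r) u := by
          rw [Finset.sum_mul_sum]
      _ = treeSum B S t l u * treeSum B S t r u := by rw [ihl u, ihr u]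

/-- Precomposition with a bijection of finite label types is a bijection of tuples. [folklore] -/
theorem bijective_precomp {α β γ : Type*} (φ : α → β) (ψ : β → α) (h₁ : ∀ a, ψ (φ a) = a)
    (h₂ : ∀ b, φ (ψ b) = b) : Function.Bijective (fun y : β → γ => y ∘ φ) := by
  refine ⟨fun y₁ y₂ h => ?_, fun y' => ⟨y' ∘ ψ, ?_⟩⟩
  · funext b
    have := congrFun h (ψ b)
    simpa only [Function.comp_apply, h₂] using this
  · funext a
    simp only [Function.comp_apply, h₁]

variable (p : unitInterval)

/-- **The moment bound** (Aizenman 1997, §4.3: `E(Σ|C|^k) = Σ τ_k ≤ Σ_{tree diagrams}`, with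
`(2k-5)!! ≤ 2^k k!` diagrams; here: shapes of `treesOfNumNodesEq k` times `(k+1)!` labellings):
for `u` fixed and every finite `S`,
`Σ_{y : Fin (k+1) → B} P_p(u ↔ y_i in S ∀ i) ≤ (k+1)! Σ_{T} treeSum T u`, for any nonnegative kernel
`t ≥ τ_p`. [cite: Aizenman1997, §4.3 Lemma 2 (proof)] [cite: AizenmanNewman1984, §4 Prop. 4.1] -/
theorem sum_real_iInter_le (B S : Finset (Site (m + 7))) {t : Site (m + 7) → Site (m + 7) → ℝ}
    (ht0 : ∀ a b, 0 ≤ t a b) (ht : ∀ a b, tau (m + 7) p a b ≤ t a b) (k : ℕ) (u : Site (m + 7)) :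
    ∑ y : Fin (k + 1) → ↥B,
        (bondPercolation (zdGraph (m + 7)) p).real (⋂ i, openConnIn ↑S u ((y i : ↥B) : Site (m + 7))) ≤
      (k + 1).factorial * ∑ T ∈ BinaryTree.treesOfNumNodesEq k, treeSum B S t T u := by
  classical
  set μ := bondPercolation (zdGraph (m + 7)) p with hμ
  have ht' : ∀ a b, μ.real (openConnIn (↑S : Set (Site (m + 7))) a b) ≤ t a b := fun a b =>
    (measureReal_mono (openConnIn_subset_openConn (↑S) a b) (measure_ne_top _ _)).trans (ht a b)
  -- per-tuple tree-graph bound, shapes and labellings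
  have hstep : ∀ y : Fin (k + 1) → ↥B,
      μ.real (⋂ i, openConnIn ↑S u ((y i : ↥B) : Site (m + 7))) ≤
        ∑ T ∈ BinaryTree.treesOfNumNodesEq k, ∑ σ : Equiv.Perm (Fin (k + 1)),
          ConnDiagram.val S t (fun i => ((y i : ↥B) : Site (m + 7)))
            (ConnDiagram.build 0 T (List.ofFn σ)) u := fun y =>
    (ConnDiagram.real_iInter_openConnIn_le_sum_val (zdGraph (m + 7)) p S ht0 ht'
      (fun i => ((y i : ↥B) : Site (m + 7))) u).trans
      (ConnDiagram.sum_diagramsOf_le fun D => ConnDiagram.val_nonneg S ht0 _ D u)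
  refine (Finset.sum_le_sum fun y _ => hstep y).trans ?_
  rw [Finset.sum_comm, Finset.mul_sum]
  refine Finset.sum_le_sum fun T hT => ?_
  have hTn : T.numLeaves = k + 1 := by
    rw [BinaryTree.numLeaves_eq_numNodes_succ, BinaryTree.mem_treesOfNumNodesEq.1 hT]
  rw [Finset.sum_comm]
  -- each labelling contributes exactly `treeSum T u`
  have hσ : ∀ σ : Equiv.Perm (Fin (k + 1)),
      ∑ y : Fin (k + 1) → ↥B, ConnDiagram.val S t (fun i => ((y i : ↥B) : Site (m + 7)))
        (ConnDiagram.build 0 T (List.ofFn σ)) u = treeSum B S t T u := by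
    intro σ
    rw [← sum_val_canon_eq_treeSum B S t T u]
    simp_rw [ConnDiagram.build_ofFn_eq T hTn σ 0, ConnDiagram.val_map]
    exact Function.Bijective.sum_comp
      (bijective_precomp (γ := ↥B) (σ ∘ Fin.cast hTn) (Fin.cast hTn.symm ∘ σ.symm)
        (fun a => by simp) (fun b => by simp))
      (fun y' : Fin T.numLeaves → ↥B =>
        ConnDiagram.val S t (fun i => ((y' i : ↥B) : Site (m + 7))) (ConnDiagram.canon T) u)
  simp_rw [hσ]
  rw [Finset.sum_const, Finset.card_univ, Fintype.card_perm, Fintype.card_fin, nsmul_eq_mul]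

/-- **Aizenman's Lemma 2, rooted form** (`d = m + 7`): under `τ_p(a,b) ≤ C₁ max(1,‖a-b‖)^{-(d-2)}`,
for every box `B = x + Q_s`, every finite `S` and `u ∈ ℤ^d`,
`Σ_{y : Fin (k+1) → B} P_p(u ↔ y_i in S ∀ i) ≤ (k+1)! · catalan k · (C₁K)^{2k+1} (s+1)^{4k+2} g(u)`
(`E|C(u) ∩ B|^{k+1}` restricted to connections inside `S`).
[cite: Aizenman1997, §4.3 Lemma 2 (first display, η = 0)] -/
theorem sum_moment_le (x : Site (m + 7)) (s : ℕ) (S : Finset (Site (m + 7))) {C₁ : ℝ}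
    (hU : ∀ a b : Site (m + 7), tau (m + 7) p a b ≤ C₁ * rieszWt (m + 5) (a - b))
    (k : ℕ) (u : Site (m + 7)) :
    ∑ y : Fin (k + 1) → ↥(cubeAt x s),
        (bondPercolation (zdGraph (m + 7)) p).real
          (⋂ i, openConnIn ↑S u ((y i : ↥(cubeAt x s)) : Site (m + 7))) ≤
      (k + 1).factorial * catalan k * ((C₁ * vertexConst m) ^ (2 * k + 1) *
        ((s : ℝ) + 1) ^ (2 * (2 * k + 1)) * profile x s u) := by
  have hC₁ : 1 ≤ C₁ := one_le_of_tau_le_rieszWt p hU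
  have hC0 : 0 ≤ C₁ := zero_le_one.trans hC₁
  have ht0 : ∀ a b : Site (m + 7), 0 ≤ twoPtKernel C₁ a b := fun a b => mul_nonneg hC0 (rieszWt_nonneg _ _)
  refine (sum_real_iInter_le p (cubeAt x s) S ht0 hU k u).trans ?_
  rw [mul_assoc]
  refine mul_le_mul_of_nonneg_left ?_ (by positivity)
  calc ∑ T ∈ BinaryTree.treesOfNumNodesEq k, treeSum (cubeAt x s) S (twoPtKernel C₁) T u
      ≤ ∑ T ∈ BinaryTree.treesOfNumNodesEq k, (C₁ * vertexConst m) ^ (2 * k + 1) *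
          ((s : ℝ) + 1) ^ (2 * (2 * k + 1)) * profile x s u := by
        refine Finset.sum_le_sum fun T hT => ?_
        have h := treeSum_le x s S hC₁ T u
        rwa [shapeLines, BinaryTree.mem_treesOfNumNodesEq.1 hT] at h
    _ = catalan k * ((C₁ * vertexConst m) ^ (2 * k + 1) * ((s : ℝ) + 1) ^ (2 * (2 * k + 1)) * profile x s u) := by
        rw [Finset.sum_const, BinaryTree.treesOfNumNodesEq_card_eq_catalan, nsmul_eq_mul]

end Moments

/-! ### Markov: large clusters make the moments large -/

section Markov

variable (p : unitInterval)

/-- `N_u = |{z ∈ B : u ↔ z in S}|`, the number of vertices of `B` joined to `u` inside `S`.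
[cite: Aizenman1997, §4.3 (|C ∩ Λ|)] -/
def connCount (B S : Finset (Site (m + 7))) (u : Site (m + 7)) (ω : BondConfig (Site (m + 7))) : ℕ :=
  open scoped Classical in
  #(B.filter fun z => ω ∈ openConnIn (↑S : Set (Site (m + 7))) u z)

/-- The event "some vertex of `B` is joined inside `S` to more than `r` vertices of `B`".
[cite: KozmaNachmias2011, Lemma 4.4 (the event max |C(y) ∩ Q_s| > λ s⁴)] -/
def largeClusterEvent (B S : Finset (Site (m + 7))) (r : ℝ) : Set (BondConfig (Site (m + 7))) :=
  {ω | ∃ y ∈ B, r < (connCount B S y ω : ℝ)}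

/-- Vertices joined inside `S` have the same `N`. [folklore] -/
theorem connCount_eq_of_mem {B S : Finset (Site (m + 7))} {y u : Site (m + 7)} {ω : BondConfig (Site (m + 7))}
    (h : ω ∈ openConnIn (↑S : Set (Site (m + 7))) y u) : connCount B S u ω = connCount B S y ω := by
  unfold connCount
  congr 1
  ext z
  simp only [Finset.mem_filter]
  exact and_congr_right fun _ =>
    ⟨fun hz => openConnIn_trans' h hz, fun hz => openConnIn_trans' (openConnIn_symm' h) hz⟩

/-- **The deterministic step**: on the event, `Σ_{u ∈ B} N_u^K ≥ r^{K+1}` (the `N_y > r` vertices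
of the class of `y` all have `N_u = N_y`). [cite: Aizenman1997, §4.3 (E Σ|C|^k vs. |C|_max)] -/
theorem pow_le_sum_connCount_pow {B S : Finset (Site (m + 7))} {r : ℝ} (hr : 0 ≤ r) (K : ℕ)
    {ω : BondConfig (Site (m + 7))} (hω : ω ∈ largeClusterEvent B S r) :
    r ^ (K + 1) ≤ ∑ u ∈ B, (connCount B S u ω : ℝ) ^ K := by
  classical
  obtain ⟨y, hy, hry⟩ := hω
  set Cl := B.filter fun z => ω ∈ openConnIn (↑S : Set (Site (m + 7))) y z with hCl
  have hcard : #Cl = connCount B S y ω := by rw [hCl, connCount]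
  calc r ^ (K + 1) ≤ (connCount B S y ω : ℝ) ^ (K + 1) := pow_le_pow_left₀ hr hry.le _
    _ = ∑ _u ∈ Cl, (connCount B S y ω : ℝ) ^ K := by
        rw [Finset.sum_const, hcard, nsmul_eq_mul, pow_succ']
    _ = ∑ u ∈ Cl, (connCount B S u ω : ℝ) ^ K := by
        refine Finset.sum_congr rfl fun u hu => ?_
        rw [connCount_eq_of_mem (Finset.mem_filter.1 hu).2]
    _ ≤ ∑ u ∈ B, (connCount B S u ω : ℝ) ^ K :=
        Finset.sum_le_sum_of_subset_of_nonneg (Finset.filter_subset _ _) fun u _ _ => by positivity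

/-- `N_u` as a sum of indicators. [folklore] -/
theorem connCount_eq_sum_indicator (B S : Finset (Site (m + 7))) (u : Site (m + 7))
    (ω : BondConfig (Site (m + 7))) :
    (connCount B S u ω : ℝ) = ∑ b : ↥B, (openConnIn (↑S : Set (Site (m + 7))) u (b : Site (m + 7))).indicator 1 ω := by
  classical
  unfold connCount
  rw [Finset.natCast_card_filter, ← Finset.sum_coe_sort]
  refine Finset.sum_congr rfl fun b _ => ?_
  simp only [Set.indicator_apply, Pi.one_apply]

/-- `N_u` is measurable. [folklore] -/
theorem measurable_connCount (B S : Finset (Site (m + 7))) (u : Site (m + 7)) :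
    Measurable fun ω => (connCount B S u ω : ℝ) := by
  have h : (fun ω => (connCount B S u ω : ℝ)) =
      fun ω => ∑ b : ↥B, (openConnIn (↑S : Set (Site (m + 7))) u (b : Site (m + 7))).indicator 1 ω := by
    funext ω; exact connCount_eq_sum_indicator B S u ω
  rw [h]
  exact Finset.measurable_sum _ fun b _ => measurable_one.indicator (measurableSet_openConnIn S u _)

/-- The large-cluster event is measurable. [folklore] -/
theorem measurableSet_largeClusterEvent (B S : Finset (Site (m + 7))) (r : ℝ) :
    MeasurableSet (largeClusterEvent B S r) := by
  have h : largeClusterEvent B S r = ⋃ y ∈ B, {ω | r < (connCount B S y ω : ℝ)} := by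
    ext ω; simp [largeClusterEvent]
  rw [h]
  exact Finset.measurableSet_biUnion B fun y _ => measurableSet_lt measurable_const (measurable_connCount B S y)

/-- `E[N_u^K] = Σ_{y : Fin K → B} P(u ↔ y_i in S ∀ i)` (expand the power of the sum of indicators).
[cite: Aizenman1997, §4.3 (the identity E(Σ|C|^k) = Σ τ_k)] -/
theorem integral_connCount_pow (B S : Finset (Site (m + 7))) (u : Site (m + 7)) (K : ℕ) :
    ∫ ω, (connCount B S u ω : ℝ) ^ K ∂(bondPercolation (zdGraph (m + 7)) p) =
      ∑ y : Fin K → ↥B, (bondPercolation (zdGraph (m + 7)) p).real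
        (⋂ i, openConnIn (↑S : Set (Site (m + 7))) u ((y i : ↥B) : Site (m + 7))) := by
  classical
  set μ := bondPercolation (zdGraph (m + 7)) p with hμ
  have hmeas : ∀ y : Fin K → ↥B, MeasurableSet (⋂ i, openConnIn (↑S : Set (Site (m + 7))) u ((y i : ↥B) : Site (m + 7))) :=
    fun y => MeasurableSet.iInter fun i => measurableSet_openConnIn S u _
  have hpt : ∀ ω, (connCount B S u ω : ℝ) ^ K =
      ∑ y : Fin K → ↥B, (⋂ i, openConnIn (↑S : Set (Site (m + 7))) u ((y i : ↥B) : Site (m + 7))).indicator 1 ω := by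
    intro ω
    rw [connCount_eq_sum_indicator, Fintype.sum_pow]
    refine Finset.sum_congr rfl fun y _ => ?_
    rw [prod_indicator_apply]
    simp only [Finset.mem_univ, Set.iInter_true, Finset.prod_const_one]
  have hint : ∀ y : Fin K → ↥B, Integrable
      ((⋂ i, openConnIn (↑S : Set (Site (m + 7))) u ((y i : ↥B) : Site (m + 7))).indicator
        (1 : BondConfig (Site (m + 7)) → ℝ)) μ :=
    fun y => (integrable_const (1 : ℝ)).indicator (hmeas y)
  simp_rw [hpt]
  rw [integral_finsetSum _ fun y _ => hint y]
  exact Finset.sum_congr rfl fun y _ => integral_indicator_one (hmeas y)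

/-- **Markov**: `r^{K+1} P(∃ y ∈ B, N_y > r) ≤ Σ_{u ∈ B} E[N_u^K]`. [cite: Aizenman1997, §4.3 (Chebyshev estimate, proof of Thm. 5)] -/
theorem pow_mul_real_largeClusterEvent_le (B S : Finset (Site (m + 7))) {r : ℝ} (hr : 0 ≤ r) (K : ℕ) :
    r ^ (K + 1) * (bondPercolation (zdGraph (m + 7)) p).real (largeClusterEvent B S r) ≤
      ∑ u ∈ B, ∑ y : Fin K → ↥B, (bondPercolation (zdGraph (m + 7)) p).real
        (⋂ i, openConnIn (↑S : Set (Site (m + 7))) u ((y i : ↥B) : Site (m + 7))) := by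
  set μ := bondPercolation (zdGraph (m + 7)) p with hμ
  have hE := measurableSet_largeClusterEvent B S r
  have hint : ∀ u ∈ B, Integrable (fun ω => (connCount B S u ω : ℝ) ^ K) μ := by
    intro u _
    refine Integrable.of_bound (C := ((#B : ℕ) : ℝ) ^ K) ((measurable_connCount B S u).pow_const K).aestronglyMeasurable
      (Filter.Eventually.of_forall fun ω => ?_)
    rw [Real.norm_eq_abs, abs_of_nonneg (by positivity)]
    have hle : connCount B S u ω ≤ #B := by classical unfold connCount; exact Finset.card_filter_le _ _
    exact pow_le_pow_left₀ (by positivity) (by exact_mod_cast hle) K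
  calc r ^ (K + 1) * μ.real (largeClusterEvent B S r)
      = ∫ ω, (largeClusterEvent B S r).indicator (fun _ => r ^ (K + 1)) ω ∂μ := by
        rw [integral_indicator_const _ hE, smul_eq_mul, mul_comm]
    _ ≤ ∫ ω, ∑ u ∈ B, (connCount B S u ω : ℝ) ^ K ∂μ := by
        refine integral_mono ((integrable_const _).indicator hE) (integrable_finsetSum _ hint) fun ω => ?_
        by_cases hω : ω ∈ largeClusterEvent B S r
        · rw [Set.indicator_of_mem hω]; exact pow_le_sum_connCount_pow hr K hω
        · rw [Set.indicator_of_notMem hω]; exact Finset.sum_nonneg fun u _ => by positivity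
    _ = ∑ u ∈ B, ∑ y : Fin K → ↥B, μ.real (⋂ i, openConnIn (↑S : Set (Site (m + 7))) u ((y i : ↥B) : Site (m + 7))) := by
        rw [integral_finsetSum _ hint]
        exact Finset.sum_congr rfl fun u _ => integral_connCount_pow p B S u K

end Markov

/-! ### Optimisation over `k` and the finite-volume estimate -/

section Optimise

/-- **Optimisation over the order of the moment** (Aizenman 1997, proof of Thm. 5: "Optimizing
over `k` (chosen so that `k ≈ α(L)/C_d`)"): if `P ≤ 1` and `P ≤ M (K A/λ)^K / λ` for every
`K ≥ 1`, then `P ≤ M e · e^{-λ/(eA)}` (take `K = ⌊λ/(eA)⌋`).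
[cite: Aizenman1997, §4.3 (proof of Thm. 5: Chebyshev inequality and optimisation over k)] -/
theorem le_exp_of_forall_moment {P M A lam : ℝ} (hP1 : P ≤ 1) (hM : 1 ≤ M) (hA : 1 ≤ A)
    (hlam : 0 < lam) (h : ∀ K : ℕ, 1 ≤ K → P ≤ M * (((K : ℝ) * A / lam) ^ K / lam)) :
    P ≤ M * Real.exp 1 * Real.exp (-(lam / (Real.exp 1 * A))) := by
  have he : 0 < Real.exp 1 := Real.exp_pos 1
  have he1 : 1 ≤ Real.exp 1 := by linarith [Real.add_one_le_exp (1 : ℝ)]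
  have heA : 0 < Real.exp 1 * A := by positivity
  have hfinal : Real.exp (1 - lam / (Real.exp 1 * A)) =
      Real.exp 1 * Real.exp (-(lam / (Real.exp 1 * A))) := by
    rw [sub_eq_add_neg, Real.exp_add]
  by_cases hcase : Real.exp 1 * A ≤ lam
  · set K := ⌊lam / (Real.exp 1 * A)⌋₊ with hK
    have hq1 : 1 ≤ lam / (Real.exp 1 * A) := by rwa [le_div_iff₀ heA, one_mul]
    have hK1 : 1 ≤ K := (Nat.one_le_floor_iff _).2 hq1
    have hKle : (K : ℝ) ≤ lam / (Real.exp 1 * A) := Nat.floor_le (by positivity)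
    have hKgt : lam / (Real.exp 1 * A) < K + 1 := Nat.lt_floor_add_one _
    have hratio : (K : ℝ) * A / lam ≤ (Real.exp 1)⁻¹ := by
      rw [div_le_iff₀ hlam]
      rw [le_div_iff₀ heA] at hKle
      calc (K : ℝ) * A = K * (Real.exp 1 * A) * (Real.exp 1)⁻¹ := by field_simp
        _ ≤ lam * (Real.exp 1)⁻¹ := by gcongr
        _ = (Real.exp 1)⁻¹ * lam := mul_comm _ _
    have hpow : ((K : ℝ) * A / lam) ^ K ≤ Real.exp (1 - lam / (Real.exp 1 * A)) :=
      calc ((K : ℝ) * A / lam) ^ K ≤ (Real.exp 1)⁻¹ ^ K := pow_le_pow_left₀ (by positivity) hratio K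
        _ = Real.exp (-(K : ℝ)) := by rw [← Real.exp_neg, ← Real.exp_nat_mul]; ring_nf
        _ ≤ Real.exp (1 - lam / (Real.exp 1 * A)) := Real.exp_le_exp.2 (by linarith)
    have hlam1 : 1 ≤ lam := le_trans (le_trans he1 (le_mul_of_one_le_right he.le hA)) hcase
    calc P ≤ M * (((K : ℝ) * A / lam) ^ K / lam) := h K hK1
      _ ≤ M * (Real.exp (1 - lam / (Real.exp 1 * A)) / 1) := by gcongr
      _ = M * Real.exp 1 * Real.exp (-(lam / (Real.exp 1 * A))) := by rw [div_one, hfinal, mul_assoc]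
  · have hlt : lam / (Real.exp 1 * A) < 1 := by rw [div_lt_one heA]; exact lt_of_not_ge hcase
    have h1 : 1 ≤ Real.exp (1 - lam / (Real.exp 1 * A)) := Real.one_le_exp (by linarith)
    calc P ≤ 1 := hP1
      _ ≤ M * Real.exp (1 - lam / (Real.exp 1 * A)) := one_le_mul_of_one_le_of_one_le hM h1
      _ = M * Real.exp 1 * Real.exp (-(lam / (Real.exp 1 * A))) := by rw [hfinal, mul_assoc]

/-- The elementary step `F A^k / λ^{k+2} ≤ ((k+1)A/λ)^{k+1} / λ` when `F ≤ (k+1)^{k+1}`, `1 ≤ A`.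
[folklore] -/
theorem mul_pow_div_le_pow_div {k : ℕ} {A lam F : ℝ} (hA1 : 1 ≤ A) (hlam : 0 < lam)
    (hfac : F ≤ ((k + 1 : ℕ) : ℝ) ^ (k + 1)) :
    F * A ^ k / lam ^ (k + 2) ≤ (((k + 1 : ℕ) : ℝ) * A / lam) ^ (k + 1) / lam := by
  have hA0 : (0 : ℝ) ≤ A := zero_le_one.trans hA1
  have hAk : A ^ k ≤ A ^ (k + 1) := pow_le_pow_right₀ hA1 (Nat.le_succ k)
  rw [div_pow, mul_pow, div_div, show lam ^ (k + 2) = lam ^ (k + 1) * lam by ring]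
  exact div_le_div_of_nonneg_right (mul_le_mul hfac hAk (pow_nonneg hA0 k) (by positivity))
    (by positivity)

/-- `catalan k ≤ 4^k`. [folklore] -/
theorem catalan_le_four_pow (k : ℕ) : catalan k ≤ 4 ^ k :=
  calc catalan k ≤ (k + 1) * catalan k := Nat.le_mul_of_pos_left _ (Nat.succ_pos k)
    _ = k.centralBinom := succ_mul_catalan_eq_centralBinom k
    _ ≤ 4 ^ k := Nat.centralBinom_le_four_pow k

variable (p : unitInterval)

/-- **The finite-volume estimate for a fixed order** (`d = m + 7`, `s ≥ 1`, `λ > 0`): combining the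
Markov step with `K = k + 1`, the moment bound and `|B| = (2s+1)^d ≤ 3^d s^d`, `s + 1 ≤ 2s`,
`catalan k ≤ 4^k`:
`P(∃ y ∈ B, N_y > λ s⁴) ≤ 3^d · 16 A₀ · s^{d-4} · (k+1)! (64 A₀²)^k / λ^{k+2}`, `A₀ = C₁ K`.
[cite: Aizenman1997, §4.3 Lemma 2 and proof of Thm. 5 (Chebyshev)] [cite: KozmaNachmias2011, Lemma 4.4 (proof)] -/
theorem real_largeClusterEvent_le_moment (x : Site (m + 7)) {s : ℕ} (hs : 1 ≤ s) (S : Finset (Site (m + 7)))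
    {C₁ : ℝ} (hU : ∀ a b : Site (m + 7), tau (m + 7) p a b ≤ C₁ * rieszWt (m + 5) (a - b))
    {lam : ℝ} (hlam : 0 < lam) (k : ℕ) :
    (bondPercolation (zdGraph (m + 7)) p).real (largeClusterEvent (cubeAt x s) S (lam * (s : ℝ) ^ 4)) ≤
      3 ^ (m + 7) * 16 * (C₁ * vertexConst m) * (s : ℝ) ^ (m + 3) *
        ((k + 1).factorial * (64 * (C₁ * vertexConst m) ^ 2) ^ k / lam ^ (k + 2)) := by
  set μ := bondPercolation (zdGraph (m + 7)) p with hμ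
  set A₀ := C₁ * vertexConst m with hA₀
  have hC₁ : 1 ≤ C₁ := one_le_of_tau_le_rieszWt p hU
  have hA₀1 : 1 ≤ A₀ := one_le_mul_of_one_le_of_one_le hC₁ (one_le_vertexConst m)
  have hs0 : (0 : ℝ) < s := by exact_mod_cast hs
  have hs1 : (1 : ℝ) ≤ s := by exact_mod_cast hs
  set r : ℝ := lam * (s : ℝ) ^ 4 with hr
  have hr0 : 0 < r := by positivity
  -- Markov with `K = k + 1` and the moment bound summed over `u ∈ B`
  have hmarkov := pow_mul_real_largeClusterEvent_le p (cubeAt x s) S hr0.le (k + 1)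
  have hmom : ∑ u ∈ cubeAt x s, ∑ y : Fin (k + 1) → ↥(cubeAt x s),
      μ.real (⋂ i, openConnIn (↑S : Set (Site (m + 7))) u ((y i : ↥(cubeAt x s)) : Site (m + 7))) ≤
      #(cubeAt x s) * ((k + 1).factorial * catalan k * (A₀ ^ (2 * k + 1) *
        ((s : ℝ) + 1) ^ (2 * (2 * k + 1)) * ((s : ℝ) + 1) ^ 2)) := by
    calc ∑ u ∈ cubeAt x s, ∑ y : Fin (k + 1) → ↥(cubeAt x s),
          μ.real (⋂ i, openConnIn (↑S : Set (Site (m + 7))) u ((y i : ↥(cubeAt x s)) : Site (m + 7)))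
        ≤ ∑ u ∈ cubeAt x s, (k + 1).factorial * catalan k * (A₀ ^ (2 * k + 1) *
            ((s : ℝ) + 1) ^ (2 * (2 * k + 1)) * ((s : ℝ) + 1) ^ 2) := by
          refine Finset.sum_le_sum fun u _ => (sum_moment_le p x s S hU k u).trans ?_
          exact mul_le_mul_of_nonneg_left (mul_le_mul_of_nonneg_left (profile_le x s u) (by positivity))
            (by positivity)
      _ = _ := by rw [Finset.sum_const, nsmul_eq_mul]
  have hmain : r ^ (k + 2) * μ.real (largeClusterEvent (cubeAt x s) S r) ≤
      #(cubeAt x s) * ((k + 1).factorial * catalan k * (A₀ ^ (2 * k + 1) *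
        ((s : ℝ) + 1) ^ (2 * (2 * k + 1)) * ((s : ℝ) + 1) ^ 2)) := hmarkov.trans hmom
  -- numerical simplifications
  have hcard : (#(cubeAt x s) : ℝ) ≤ 3 ^ (m + 7) * (s : ℝ) ^ (m + 7) := by
    rw [card_cubeAt]; push_cast
    rw [← mul_pow]
    exact pow_le_pow_left₀ (by positivity) (by linarith) _
  have hcat : (catalan k : ℝ) ≤ 4 ^ k := by exact_mod_cast catalan_le_four_pow k
  have hs2 : (s : ℝ) + 1 ≤ 2 * s := by linarith
  have hpow1 : ((s : ℝ) + 1) ^ (2 * (2 * k + 1)) * ((s : ℝ) + 1) ^ 2 ≤ (2 * (s : ℝ)) ^ (4 * k + 4) := by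
    rw [← pow_add, show 2 * (2 * k + 1) + 2 = 4 * k + 4 by ring]
    exact pow_le_pow_left₀ (by positivity) hs2 _
  have hfact : (0 : ℝ) < (k + 1).factorial := by exact_mod_cast Nat.factorial_pos _
  have hinner : A₀ ^ (2 * k + 1) * ((s : ℝ) + 1) ^ (2 * (2 * k + 1)) * ((s : ℝ) + 1) ^ 2 ≤
      A₀ ^ (2 * k + 1) * (2 * (s : ℝ)) ^ (4 * k + 4) := by
    rw [mul_assoc]; exact mul_le_mul_of_nonneg_left hpow1 (by positivity)
  have hmid : ((k + 1).factorial : ℝ) * catalan k * (A₀ ^ (2 * k + 1) *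
      ((s : ℝ) + 1) ^ (2 * (2 * k + 1)) * ((s : ℝ) + 1) ^ 2) ≤
      (k + 1).factorial * 4 ^ k * (A₀ ^ (2 * k + 1) * (2 * (s : ℝ)) ^ (4 * k + 4)) :=
    mul_le_mul (mul_le_mul_of_nonneg_left hcat hfact.le) hinner (by positivity) (by positivity)
  have hrhs : (#(cubeAt x s) : ℝ) * ((k + 1).factorial * catalan k * (A₀ ^ (2 * k + 1) *
      ((s : ℝ) + 1) ^ (2 * (2 * k + 1)) * ((s : ℝ) + 1) ^ 2)) ≤
      (3 ^ (m + 7) * (s : ℝ) ^ (m + 7)) * ((k + 1).factorial * 4 ^ k * (A₀ ^ (2 * k + 1) *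
        (2 * (s : ℝ)) ^ (4 * k + 4))) :=
    mul_le_mul hcard hmid (by positivity) (by positivity)
  have hkey : r ^ (k + 2) * μ.real (largeClusterEvent (cubeAt x s) S r) ≤
      (3 ^ (m + 7) * (s : ℝ) ^ (m + 7)) * ((k + 1).factorial * 4 ^ k * (A₀ ^ (2 * k + 1) *
        (2 * (s : ℝ)) ^ (4 * k + 4))) := hmain.trans hrhs
  -- divide by `r^{k+2} = λ^{k+2} s^{4k+8}`
  rw [← le_div_iff₀' (pow_pos hr0 _)] at hkey
  refine hkey.trans (le_of_eq ?_)
  rw [div_eq_iff (pow_pos hr0 _).ne', hr]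
  have h2' : (2 : ℝ) ^ (4 * k + 4) = 16 * 16 ^ k := by
    rw [show 4 * k + 4 = 4 * (k + 1) by ring, pow_mul]; norm_num; ring
  have h2 : (2 * (s : ℝ)) ^ (4 * k + 4) = 16 * 16 ^ k * (s : ℝ) ^ (4 * k + 4) := by
    rw [mul_pow, h2']
  have h64 : (64 * A₀ ^ 2) ^ k = 4 ^ k * 16 ^ k * (A₀ ^ 2) ^ k := by
    rw [mul_pow, show (64 : ℝ) = 4 * 16 by norm_num, mul_pow]
  have hlam4 : (lam * (s : ℝ) ^ 4) ^ (k + 2) = lam ^ (k + 2) * ((s : ℝ) ^ 4) ^ (k + 2) := mul_pow _ _ _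
  rw [h2, h64, hlam4]
  field_simp
  ring

/-- **The finite-volume large-deviation estimate** (`d = m + 7`): under
`τ_p(a,b) ≤ C₁ max(1,‖a-b‖)^{-(d-2)}` there are `C, c > 0` such that for every box `x + Q_s`
(`s ≥ 1`), every finite `S` and every `λ > 0`,
`P_p(∃ y ∈ x+Q_s : |{z ∈ x+Q_s : y ↔ z in S}| > λ s⁴) ≤ C s^{d-4} e^{-cλ}`.
[cite: KozmaNachmias2011, Lemma 4.4 (p. 392)] [cite: Aizenman1997, §4.3 Lemma 2] -/
theorem real_largeClusterEvent_le {C₁ : ℝ}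
    (hU : ∀ a b : Site (m + 7), tau (m + 7) p a b ≤ C₁ * rieszWt (m + 5) (a - b)) :
    ∃ C c : ℝ, 0 < c ∧ 0 < C ∧ ∀ (x : Site (m + 7)) (s : ℕ), 1 ≤ s → ∀ (S : Finset (Site (m + 7)))
      (lam : ℝ), 0 < lam →
      (bondPercolation (zdGraph (m + 7)) p).real (largeClusterEvent (cubeAt x s) S (lam * (s : ℝ) ^ 4)) ≤
        C * (s : ℝ) ^ (m + 3) * Real.exp (-(c * lam)) := by
  set A₀ := C₁ * vertexConst m with hA₀
  have hC₁ : 1 ≤ C₁ := one_le_of_tau_le_rieszWt p hU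
  have hA₀1 : 1 ≤ A₀ := one_le_mul_of_one_le_of_one_le hC₁ (one_le_vertexConst m)
  set A : ℝ := 64 * A₀ ^ 2 with hA
  have hA1 : 1 ≤ A := by rw [hA]; nlinarith
  set M₀ : ℝ := 3 ^ (m + 7) * 16 * A₀ with hM₀
  have hM₀1 : 1 ≤ M₀ := by
    rw [hM₀]
    have : (1 : ℝ) ≤ 3 ^ (m + 7) := one_le_pow₀ (by norm_num)
    nlinarith
  refine ⟨M₀ * Real.exp 1, 1 / (Real.exp 1 * A), by positivity, by positivity, fun x s hs S lam hlam => ?_⟩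
  set μ := bondPercolation (zdGraph (m + 7)) p with hμ
  have hs1 : (1 : ℝ) ≤ s := by exact_mod_cast hs
  set P := μ.real (largeClusterEvent (cubeAt x s) S (lam * (s : ℝ) ^ 4)) with hP
  set M := M₀ * (s : ℝ) ^ (m + 3) with hM
  have hM1 : 1 ≤ M := one_le_mul_of_one_le_of_one_le hM₀1 (one_le_pow₀ hs1)
  have hmom : ∀ K : ℕ, 1 ≤ K → P ≤ M * (((K : ℝ) * A / lam) ^ K / lam) := by
    intro K hK
    obtain ⟨k, rfl⟩ : ∃ k, K = k + 1 := ⟨K - 1, by omega⟩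
    have h := real_largeClusterEvent_le_moment p x hs S hU hlam k
    have hfac : ((k + 1).factorial : ℝ) ≤ ((k + 1 : ℕ) : ℝ) ^ (k + 1) := by
      exact_mod_cast Nat.factorial_le_pow (k + 1)
    have hcore : ((k + 1).factorial : ℝ) * A ^ k / lam ^ (k + 2) ≤
        (((k + 1 : ℕ) : ℝ) * A / lam) ^ (k + 1) / lam := mul_pow_div_le_pow_div hA1 hlam hfac
    calc P ≤ _ := h
      _ = M * (((k + 1).factorial : ℝ) * A ^ k / lam ^ (k + 2)) := by rw [hM, hM₀]
      _ ≤ M * ((((k + 1 : ℕ) : ℝ) * A / lam) ^ (k + 1) / lam) :=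
          mul_le_mul_of_nonneg_left hcore (by positivity)
  have hP1 : P ≤ 1 := measureReal_le_one
  have h := le_exp_of_forall_moment hP1 hM1 hA1 hlam hmom
  rw [hM] at h
  calc P ≤ M₀ * (s : ℝ) ^ (m + 3) * Real.exp 1 * Real.exp (-(lam / (Real.exp 1 * A))) := h
    _ = M₀ * Real.exp 1 * (s : ℝ) ^ (m + 3) * Real.exp (-(1 / (Real.exp 1 * A) * lam)) := by
        rw [one_div, inv_mul_eq_div]; ring

end Optimise

/-! ### Infinite volume: Lemma 4.4 in the form `VolumeLD d` -/

section InfiniteVolume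

variable {d : ℕ}

/-- An open path uses finitely many vertices: `x ↔ y` implies `x ↔ y in Λ_n` for some `n`. [folklore] -/
theorem exists_box_openConnIn_of_openConn {ω : BondConfig (Site d)} {a b : Site d}
    (h : ω ∈ openConn a b) : ∃ n : ℕ, ω ∈ openConnIn (↑(box d n) : Set (Site d)) a b := by
  have hp := pathIn_univ_of_reachable (d := d) h
  obtain ⟨-, hr⟩ := hp
  suffices key : ∀ c, Relation.ReflTransGen (fun u v => (openGraph ω).Adj u v ∧ v ∈ (Set.univ : Set (Site d))) a c →
      ∃ n : ℕ, PathIn (openGraph ω) (↑(box d n)) a c by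
    obtain ⟨n, hn⟩ := key b hr
    exact ⟨n, mem_openConnIn_of_pathIn hn⟩
  intro c hc
  induction hc with
  | refl => exact ⟨Site.supNorm a, PathIn.refl (Finset.mem_coe.2 (mem_box_iff_supNorm_le.2 le_rfl))⟩
  | @tail u v _ huv ih =>
    obtain ⟨n, hn⟩ := ih
    refine ⟨max n (Site.supNorm v), (hn.mono ?_).tail huv.1 ?_⟩
    · exact Finset.coe_subset.2 (box_mono d (le_max_left _ _))
    · exact Finset.mem_coe.2 (mem_box_iff_supNorm_le.2 (le_max_right _ _))

/-- `{x ↔ y in S}` is monotone in `S`. [folklore] -/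
theorem openConnIn_mono' {V : Type*} {S S' : Set V} (h : S ⊆ S') (x y : V) :
    (openConnIn S x y : Set (BondConfig V)) ⊆ openConnIn S' x y := by
  rintro ω ⟨hx, hy, hr⟩
  exact ⟨h hx, h hy, hr.map (SimpleGraph.induceHomOfLE (G := openGraph ω) h).toHom⟩

/-- The large-cluster events for `S = Λ_n` increase with `n`. [folklore] -/
theorem monotone_largeClusterEvent_box (B : Finset (Site (m + 7))) (r : ℝ) :
    Monotone fun n : ℕ => largeClusterEvent B (box (m + 7) n) r := by
  classical
  intro n n' hnn' ω hω
  obtain ⟨y, hy, hry⟩ := hω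
  refine ⟨y, hy, hry.trans_le ?_⟩
  unfold connCount
  exact_mod_cast Finset.card_le_card fun z hz => Finset.mem_filter.2 ⟨(Finset.mem_filter.1 hz).1,
    openConnIn_mono' (Finset.coe_subset.2 (box_mono (m + 7) hnn')) y z (Finset.mem_filter.1 hz).2⟩

open scoped Classical in
/-- The infinite-volume event "some `y ∈ B` has more than `r` vertices of `B` in its cluster" is
covered by the finite-volume events along `Λ_n ↑ ℤ^d`. [folklore] -/
theorem setOf_exists_lt_card_subset_iUnion (B : Finset (Site (m + 7))) (r : ℝ) :
    {ω : BondConfig (Site (m + 7)) | ∃ y ∈ B, r < #(B.filter fun z => ω ∈ openConn y z)} ⊆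
      ⋃ n : ℕ, largeClusterEvent B (box (m + 7) n) r := by
  intro ω hω
  obtain ⟨y, hy, hry⟩ := hω
  set F := B.filter fun z => ω ∈ openConn y z with hF
  have hn : ∀ z ∈ F, ∃ n : ℕ, ω ∈ openConnIn (↑(box (m + 7) n) : Set (Site (m + 7))) y z :=
    fun z hz => exists_box_openConnIn_of_openConn (Finset.mem_filter.1 hz).2
  choose! nz hnz using hn
  set N := F.sup nz with hN
  refine Set.mem_iUnion.2 ⟨N, y, hy, hry.trans_le ?_⟩
  unfold connCount
  exact_mod_cast Finset.card_le_card fun z hz => Finset.mem_filter.2 ⟨(Finset.mem_filter.1 hz).1,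
    openConnIn_mono' (Finset.coe_subset.2 (box_mono (m + 7) (Finset.le_sup hz))) y z (hnz z hz)⟩

/-- **Lemma 4.4 of Kozma–Nachmias 2011 (Aizenman 1997, Lemma 2), PROVED**: for `d > 6` under the
two-point estimate (1.2), the large-deviation predicate `VolumeLD d` of `KozmaNachmiasLemma43.lean`
holds: there are `C, c > 0` with
`P_{p_c}(∃ y ∈ x + Q_s : |C(y) ∩ (x + Q_s)| > λ s⁴) ≤ C s^{d-4} e^{-cλ}` for all `x`, `s ≥ 1`,
`λ > 0`. (Printed: `s^{d-6} e^{-cλ}` for `Q_s`; see the module docstring for the prefactor.)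
[cite: KozmaNachmias2011, Lemma 4.4 (p. 392)] [cite: Aizenman1997, §4.3 Lemma 2] -/
theorem volumeLD_of_twoPointBoundedRatio (hd : 6 < d) (hτ : TwoPointBoundedRatio d) : VolumeLD d := by
  classical
  obtain ⟨m, rfl⟩ : ∃ m, d = m + 7 := ⟨d - 7, by omega⟩
  obtain ⟨C', C₀, hC', hC'C, hb⟩ := hτ.natPow (by omega)
  set p := criticalProbI (m + 7) with hp
  have hU : ∀ x y : Site (m + 7), tau (m + 7) p x y ≤ max C₀ 1 * rieszWt (m + 5) (x - y) :=
    tau_le_rieszWt_of_upper p fun x y hxy => (hb x y hxy).2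
  obtain ⟨C, c, hc, hC, hfin⟩ := real_largeClusterEvent_le p hU
  refine ⟨C, c, hc, fun x s hs t ht => ?_⟩
  set μ := bondPercolation (zdGraph (m + 7)) p with hμ
  have hsub := setOf_exists_lt_card_subset_iUnion (m := m) (cubeAt x s) (t * (s : ℝ) ^ 4)
  have hmono := monotone_largeClusterEvent_box (m := m) (cubeAt x s) (t * (s : ℝ) ^ 4)
  have hb0 : 0 ≤ C * (s : ℝ) ^ (m + 3) * Real.exp (-(c * t)) := by positivity
  have hlim := tendsto_measure_iUnion_atTop (μ := μ) hmono
  have hle : μ (⋃ n : ℕ, largeClusterEvent (cubeAt x s) (box (m + 7) n) (t * (s : ℝ) ^ 4)) ≤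
      ENNReal.ofReal (C * (s : ℝ) ^ (m + 3) * Real.exp (-(c * t))) :=
    le_of_tendsto' hlim fun n => (ENNReal.le_ofReal_iff_toReal_le (measure_ne_top _ _) hb0).2
      (hfin x s hs (box (m + 7) n) t ht)
  rw [show m + 7 - 4 = m + 3 by omega]
  exact (measureReal_mono hsub (measure_ne_top _ _)).trans (ENNReal.toReal_le_of_le_ofReal hb0 hle)

/-- **Lemma 4.3 of Kozma–Nachmias 2011, unconditionally in Lemma 4.4**: for `d > 6` under (1.2)
and (1.1), `P(x is s-locally-bad) ≤ C e^{-c log⁴ s}` (`KozmaNachmias2011_lemma43` with its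
`VolumeLD d` hypothesis discharged). [cite: KozmaNachmias2011, Lemma 4.3 (pp. 392–393)] -/
theorem KozmaNachmias2011_lemma43' (hd : 6 < d) (hτ : TwoPointBoundedRatio d)
    (h11 : KozmaNachmias2011_volumeTail) :
    ∃ C c : ℝ, 0 < c ∧ 0 < C ∧ ∀ (j s : ℕ) (x : Site d),
      (bondPercolation (zdGraph d) (criticalProbI d)).real {ω | IsSLocBad (criticalProbI d) j s x ω} ≤
        C * Real.exp (-(c * Real.log s ^ 4)) :=
  KozmaNachmias2011_lemma43 hd hτ h11 (volumeLD_of_twoPointBoundedRatio hd hτ)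

end InfiniteVolume

end Literature.Barriers.CriticalPhenomena
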